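import Summits.NavierStokesRegularity.NavierStokesRegularity.Theorems.AdaptedFrequencyAdaptedFrequencyConvergesStubBlockSolverCorrector
import Summits.NavierStokesRegularity.NavierStokesRegularity.Theorems.AdaptedFrequencyAdaptedFrequencyConvergesStubBlockSolverDecay
import Summits.NavierStokesRegularity.NavierStokesRegularity.Theorems.AdaptedFrequencyAdaptedFrequencyConvergesStubBlockSolverEnvelope
import Summits.NavierStokesRegularity.NavierStokesRegularity.Theorems.AdaptedFrequencyAdaptedFrequencyConvergesStubBlockSolverTerminal
import Summits.NavierStokesRegularity.NavierStokesRegularity.Theorems.AdaptedFrequencyAdaptedKernelExistsHypoelliptic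
import Summits.NavierStokesRegularity.NavierStokesRegularity.Theorems.AdaptedFrequencyAdaptedKernelExistsPrekernelComparison
import Summits.NavierStokesRegularity.NavierStokesRegularity.Theorems.AdaptedFrequencyAdaptedKernelExistsPrekernelPositivity

/-!
# Crux `AdaptedFrequencyConverges` (stmt-NavierStokesRegularity-10493), line
  `cloud-frame-effective-tsai`: the block solver for a CUT-OFF drift (STUB `stub_blockSolver`)

Helper file (lands `--supports stmt-NavierStokesRegularity-10493`).  For `ν > 0`, `B ≥ 0`,
times `tb < tₘ < T` and smooth compactly supported data `f ≥ 0` there are constants `A`, `a > 0`,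
`M` such that EVERY drift `b` jointly smooth on `Ico tb T × ℝ³`, divergence free, `‖b‖ ≤ B`, and
vanishing on `[T₁, T)` for some `T₁ ∈ (tₘ, T)`, admits a function `W` on the open slab
`Ioo tₘ T × ℝ³` which is jointly smooth, solves `∂ₜW + b·∇W + νΔW = 0` classically and very
weakly, and satisfies `0 ≤ W ≤ A e^{−‖x‖²/a}` and `|W(t, x) − e^{ν(T−t)Δ}f(x)| ≤ M (T − t)`
(`blockSolver_approx`).  The constants do NOT depend on the cut-off, which is what the passage
to the limit `T₁ ↑ T` needs.

Assembly (pattern of the tree's `cauchyKernel` / `stub_prekernelBounds`, crux `AdaptedKernelExists`):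
`W = g`, the smooth representative (`stub_hypoelliptic`, Hörmander) of `F + w`, `F` the backward
caloric extension of `f` (`…StubBlockSolverCaloric`) and `w` the `L²` corrector of
`corrector_cutoff`; `g = F` above the strip (`approx_eq_above`); decay at spatial infinity
(`decay_of_majorant`), positivity (`prekernel_nonneg_of_decay`), the upper comparison
(`prekernel_comparison`) turned into the envelope by `envelope_of_comparison`, and the terminal
layer estimate `terminal_comparison`.
-/

noncomputable section

open MeasureTheory Set Filter Topology Metric Function Real
open scoped Laplacian ContDiff
open Literature.Analysis.FluidPDE Literature.Analysis.UnboundedOperators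
open Summit.NavierStokesRegularity.NavierStokesRegularity.Theorems.AdaptedKernelExists.NashEntropyLastBlock

namespace Summit.NavierStokesRegularity.NavierStokesRegularity.Theorems.AdaptedFrequencyConverges.CloudFrameEffectiveTsai

/-- **`g = F` above the strip.** If `F + w = g` a.e. on the open slab `Ioo ta T × ℝ³`, `F` is
continuous on `Iio T × ℝ³`, `w = 0` off `Ioo ta Ta × ℝ³` and `g` is jointly smooth on the slab,
then `g(t, ·) = F(t, ·)` for every `t ∈ Ico Ta T` (a.e.-equal continuous functions agree on the
open set `Ioo Ta T × ℝ³`; continuity of both time lines at `Ta`). -/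
theorem approx_eq_above {ta Ta T : ℝ} {F : ℝ → EuclideanSpace ℝ (Fin 3) → ℝ}
    {w : ℝ × EuclideanSpace ℝ (Fin 3) → ℝ} {g : ℝ → EuclideanSpace ℝ (Fin 3) → ℝ}
    (hta : ta < Ta) (hTa : Ta < T) (hFc : ContinuousOn (uncurry F) (Iio T ×ˢ univ))
    (hw0 : ∀ p : ℝ × EuclideanSpace ℝ (Fin 3), p.1 ∉ Ioo ta Ta → w p = 0)
    (hg : IsSmoothSpaceTimeOn (Ioo ta T) g)
    (hae : ∀ᵐ p : ℝ × EuclideanSpace ℝ (Fin 3), p ∈ Ioo ta T ×ˢ univ →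
      F p.1 p.2 + w p = g p.1 p.2) :
    ∀ t ∈ Ico Ta T, g t = F t := by
  have hU : IsOpen (Ioo Ta T ×ˢ (univ : Set (EuclideanSpace ℝ (Fin 3)))) :=
    isOpen_Ioo.prod isOpen_univ
  have hsub : Ioo Ta T ×ˢ (univ : Set (EuclideanSpace ℝ (Fin 3))) ⊆ Ioo ta T ×ˢ univ :=
    prod_mono (Ioo_subset_Ioo_left hta.le) Subset.rfl
  have hgc : ContinuousOn (uncurry g) (Ioo Ta T ×ˢ univ) := hg.continuousOn.mono hsub
  have hΓc : ContinuousOn (uncurry F) (Ioo Ta T ×ˢ univ) :=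
    hFc.mono (prod_mono Ioo_subset_Iio_self Subset.rfl)
  have hae' : uncurry g =ᵐ[volume.restrict (Ioo Ta T ×ˢ univ)] uncurry F := by
    rw [EventuallyEq, ae_restrict_iff' hU.measurableSet]
    filter_upwards [hae] with p hp hpU
    have h1 := hp (hsub hpU)
    have h2 : w p = 0 := hw0 p fun h => lt_irrefl _ (h.2.trans hpU.1.1)
    show g p.1 p.2 = F p.1 p.2
    rw [← h1, h2, add_zero]
  have hEq : EqOn (uncurry g) (uncurry F) (Ioo Ta T ×ˢ univ) :=
    Measure.eqOn_open_of_ae_eq hae' hU hgc hΓc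
  have hopen : ∀ t ∈ Ioo Ta T, ∀ x, g t x = F t x := fun t ht x =>
    hEq (mk_mem_prod ht (mem_univ x))
  intro t ht
  funext x
  rcases eq_or_lt_of_le ht.1 with h | h
  · subst h
    have hc1 : Continuous fun s : ℝ => ((s, x) : ℝ × EuclideanSpace ℝ (Fin 3)) := by fun_prop
    have hga : ContinuousAt (fun s => g s x) Ta := by
      have h1 : ContinuousAt (uncurry g) (Ta, x) :=
        hg.continuousOn.continuousAt
          ((isOpen_Ioo.prod isOpen_univ).mem_nhds ⟨⟨hta, hTa⟩, mem_univ x⟩)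
      exact ContinuousAt.comp (f := fun s : ℝ => ((s, x) : ℝ × EuclideanSpace ℝ (Fin 3))) h1
        hc1.continuousAt
    have hΓa : ContinuousAt (fun s => F s x) Ta := by
      have h1 : ContinuousAt (uncurry F) (Ta, x) :=
        hFc.continuousAt ((isOpen_Iio.prod isOpen_univ).mem_nhds ⟨hTa, mem_univ x⟩)
      exact ContinuousAt.comp (f := fun s : ℝ => ((s, x) : ℝ × EuclideanSpace ℝ (Fin 3))) h1
        hc1.continuousAt
    have hev : (fun s => g s x) =ᶠ[𝓝[>] Ta] fun s => F s x := by
      filter_upwards [Ioo_mem_nhdsGT hTa] with s hs using hopen s hs x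
    exact tendsto_nhds_unique_of_eventuallyEq (hga.tendsto.mono_left nhdsWithin_le_nhds)
      (hΓa.tendsto.mono_left nhdsWithin_le_nhds) hev
  · exact hopen t ⟨h, ht.2⟩ x

/-- **The block solver for a cut-off drift, with constants uniform in the cut-off.**  See the
module docstring. -/
theorem blockSolver_approx (ν B tb tₘ T : ℝ) (f : EuclideanSpace ℝ (Fin 3) → ℝ) (hν : 0 < ν)
    (hB : 0 ≤ B) (htb : tb < tₘ) (htₘ : tₘ < T) (hf : ContDiff ℝ 2 f)
    (hfc : HasCompactSupport f) (hf0 : ∀ x, 0 ≤ f x) :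
    ∃ A a M : ℝ, 0 < a ∧
      ∀ (b : ℝ → EuclideanSpace ℝ (Fin 3) → EuclideanSpace ℝ (Fin 3)),
        IsSmoothSpaceTimeOn (Ico tb T) b →
        (∀ t ∈ Ico tb T, VectorCalculus.IsDivFree (b t)) →
        (∀ t ∈ Ico tb T, ∀ x, ‖b t x‖ ≤ B) →
        (∃ T₁ ∈ Ioo tₘ T, ∀ t ∈ Ico T₁ T, ∀ x, b t x = 0) →
        ∃ W : ℝ → EuclideanSpace ℝ (Fin 3) → ℝ,
          IsSmoothSpaceTimeOn (Ioo tₘ T) W ∧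
          (∀ t ∈ Ioo tₘ T, ∀ x,
            deriv (fun s => W s x) t + fderiv ℝ (W t) x (b t x) + ν * (Δ (W t)) x = 0) ∧
          (∀ φ : ℝ × EuclideanSpace ℝ (Fin 3) → ℝ, ContDiff ℝ ∞ φ → HasCompactSupport φ →
            tsupport φ ⊆ Ioo tₘ T ×ˢ univ →
            ∫ p : ℝ × (EuclideanSpace ℝ (Fin 3)), W p.1 p.2 * (deriv (fun s => φ (s, p.2)) p.1 +
              fderiv ℝ (fun y => φ (p.1, y)) p.2 (b p.1 p.2) -
              ν * (Δ (fun y => φ (p.1, y))) p.2) = 0) ∧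
          (∀ t ∈ Ioo tₘ T, ∀ x, 0 ≤ W t x) ∧
          (∀ t ∈ Ioo tₘ T, ∀ x, W t x ≤ A * Real.exp (-‖x‖ ^ 2 / a)) ∧
          (∀ t ∈ Ioo tₘ T, ∀ x, |W t x - heatExtension f (ν * (T - t)) x| ≤ M * (T - t)) := by
  -- the data and its constants
  obtain ⟨C₀, C₁, C₂, hC₀, hC₁, -⟩ := caloric_data_bounds hf hfc
  obtain ⟨Cf, hCf0, hCf⟩ := caloric_data_le_heatKernel hfc hC₀
  have hC₁0 : 0 ≤ C₁ := (norm_nonneg _).trans (hC₁ 0)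
  obtain ⟨F, hF⟩ : ∃ F : ℝ → EuclideanSpace ℝ (Fin 3) → ℝ,
      F = fun t x => heatExtension f (ν * (T - t)) x := ⟨_, rfl⟩
  -- the auxiliary level
  set ta : ℝ := (tb + tₘ) / 2 with hta_def
  have htba : tb < ta := by rw [hta_def]; linarith
  have htaₘ : ta < tₘ := by rw [hta_def]; linarith
  have htaT : ta < T := htaₘ.trans htₘ
  -- the envelope constants and the terminal rate
  obtain ⟨A, a, ha, henv⟩ := envelope_of_comparison (ta := ta) (T := T) hν hB hCf0 htaT
  refine ⟨A, a, B * C₁, ha, fun b hsm hdiv hBd hT₁ => ?_⟩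
  obtain ⟨T₁, hT₁, hvan⟩ := hT₁
  set Ta : ℝ := (T₁ + T) / 2 with hTa_def
  have hta₁ : ta < T₁ := htaₘ.trans hT₁.1
  have hT₁a : T₁ < Ta := by rw [hTa_def]; linarith [hT₁.2]
  have hTaT : Ta < T := by rw [hTa_def]; linarith [hT₁.2]
  have htaTa : ta < Ta := hta₁.trans hT₁a
  have hsub : Ico ta T ⊆ Ico tb T := Ico_subset_Ico_left htba.le
  have hsmₐ : IsSmoothSpaceTimeOn (Ico ta T) b := hsm.mono hsub
  have hdivₐ : ∀ t ∈ Ico ta T, VectorCalculus.IsDivFree (b t) := fun t ht => hdiv t (hsub ht)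
  have hBₐ : ∀ t ∈ Ico ta T, ∀ x, ‖b t x‖ ≤ B := fun t ht x => hBd t (hsub ht) x
  -- facts about `F`
  have hFsm : IsSmoothSpaceTimeOn (Iio T) F := caloric_isSmoothSpaceTimeOn hν hf.continuous hfc hF
  have hF2 : ContDiffOn ℝ 2 (uncurry F) (Iio T ×ˢ univ) := hFsm.of_le (by norm_cast)
  have hFc : ContinuousOn (uncurry F) (Iio T ×ˢ univ) := hFsm.continuousOn
  have hFnn : ∀ t, t < T → ∀ x, 0 ≤ F t x := fun t ht x => caloric_nonneg hν hF hf0 ht x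
  have hFle : ∀ t, t < T → ∀ x, F t x ≤ Cf * heatKernel (ν * (T - t) + 1) x :=
    fun t ht x => caloric_le_heatKernel hν hF hCf ht x
  have hFD : ∀ t, t < T → ∀ x, ‖fderiv ℝ (F t) x‖ ≤ C₁ :=
    fun t ht x => caloric_norm_fderiv_le hν (hf.of_le one_le_two) hfc hF hC₁ ht x
  -- (1) the corrector and (2) the smooth representative
  obtain ⟨w, -, hw2, hw0, hloc, hweak⟩ :=
    corrector_cutoff hν hf hfc hF htba hta₁ hT₁a hTaT hsm hdiv hBd hvan
  obtain ⟨g, hgs, hae, hcl⟩ :=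
    stub_hypoelliptic ν ta T b (fun p => F p.1 p.2 + w p) hν htaT hsmₐ hdivₐ hloc hweak
  have hI : ∀ t ∈ Ico Ta T, g t = F t := approx_eq_above htaTa hTaT hFc hw0 hgs hae
  have hgTa : g Ta = F Ta := hI Ta ⟨le_rfl, hTaT⟩
  -- (3) decay at spatial infinity on blocks
  have hmaj : ∀ a' b' : ℝ, ta < a' → b' < T → ∃ Φ : EuclideanSpace ℝ (Fin 3) → ℝ,
      Integrable Φ ∧ ∀ s ∈ Icc a' b', ∀ x, |F s x| ≤ Φ x := by
    intro a' b' _ hb'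
    by_cases hab : a' ≤ b'
    swap
    · refine ⟨fun _ => 0, integrable_zero _ _ _, fun s hs x => ?_⟩
      exact absurd (hs.1.trans hs.2) hab
    have hσ : 0 < ν * (T - a') + 1 := by
      have := mul_nonneg hν.le (sub_nonneg.2 (hab.trans hb'.le)); linarith
    set K : ℝ := (4 * π * 1) ^ (-(Module.finrank ℝ (EuclideanSpace ℝ (Fin 3)) : ℝ) / 2) /
      (4 * π * (ν * (T - a') + 1)) ^ (-(Module.finrank ℝ (EuclideanSpace ℝ (Fin 3)) : ℝ) / 2)
      with hK
    refine ⟨fun x => Cf * (K * heatKernel (ν * (T - a') + 1) x),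
      ((integrable_heatKernel_holds hσ).const_mul K).const_mul Cf, fun s hs x => ?_⟩
    have hsT : s < T := hs.2.trans_lt hb'
    rw [abs_of_nonneg (hFnn s hsT x)]
    exact (hFle s hsT x).trans (mul_le_mul_of_nonneg_left
      (by rw [hK]; exact caloric_heatKernel_le_fixed hν ⟨hs.1, hsT⟩ x) hCf0)
  have hdec : ∀ t ∈ Ioo ta Ta, ∀ δ : ℝ, 0 < δ → ∃ ρ₀ : ℝ, ∀ s ∈ Icc t Ta, ∀ y,
      ρ₀ ≤ ‖y - (0 : EuclideanSpace ℝ (Fin 3))‖ → |g s y| ≤ δ := fun t ht δ hδ =>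
    decay_of_majorant (x₀ := 0) (H := F) hν hTaT ht hsmₐ hBₐ hw2 hgs hae hmaj hcl hδ
  -- (4) the local class on the blocks `[t, Ta]`
  have hblock : ∀ t ∈ Ioo ta Ta,
      ∃ ad : ℝ → EuclideanSpace ℝ (Fin 3) → EuclideanSpace ℝ (Fin 3),
        IsDriftHeatSolutionOn ad (fun σ => g (Ta - σ / ν)) (B / ν) (Icc 0 (ν * (Ta - t))) univ := by
    intro t ht
    obtain ⟨ad, hv⟩ := prekernel_bridge (t₁ := Ta) hν htaTa hTaT hsmₐ hBₐ hgs hcl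
    refine ⟨ad, hv.mono (fun σ hσ => ⟨hσ.1, ?_⟩) Subset.rfl⟩
    exact hσ.2.trans_lt (mul_lt_mul_of_pos_left (by linarith [ht.1]) hν)
  -- (5) positivity
  have hTa0 : ∀ z, 0 ≤ g Ta z := fun z => by rw [hgTa]; exact hFnn Ta hTaT z
  have hnn : ∀ t ∈ Ioo ta Ta, ∀ s ∈ Icc t Ta, ∀ x, 0 ≤ g s x := by
    intro t ht
    obtain ⟨ad, hv⟩ := hblock t ht
    exact prekernel_nonneg_of_decay hν hv hTa0 fun δ hδ => by
      obtain ⟨ρ₀, hρ₀⟩ := hdec t ht δ hδ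
      exact ⟨ρ₀, fun s hs y hy => (abs_le.1 (hρ₀ s hs y hy)).1⟩
  have hpos : ∀ t ∈ Ioo ta T, ∀ x, 0 ≤ g t x := by
    intro t ht x
    rcases lt_or_ge t Ta with h | h
    · exact hnn t ⟨ht.1, h⟩ t ⟨le_rfl, h.le⟩ x
    · rw [hI t ⟨h, ht.2⟩]; exact hFnn t ht.2 x
  -- (6) the upper comparison and the envelope
  have hTac : Continuous (g Ta) := (prekernel_contDiff_slice hgs ⟨htaTa, hTaT⟩).continuous
  have hTai : Integrable (g Ta) := by
    rw [hgTa]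
    have hI0 : Integrable fun x : EuclideanSpace ℝ (Fin 3) => Cf * heatKernel (ν * (T - Ta) + 1) x :=
      (integrable_heatKernel_holds (by have := mul_pos hν (sub_pos.2 hTaT); linarith)).const_mul Cf
    refine hI0.mono' ?_ (Eventually.of_forall fun x => ?_)
    · rw [← hgTa]; exact hTac.aestronglyMeasurable
    · rw [Real.norm_of_nonneg (hFnn Ta hTaT x)]; exact hFle Ta hTaT x
  have hcomp : ∀ t ∈ Ioo ta Ta, ∀ x, ∀ δ : ℝ, 0 < δ → ∃ σ₀ : ℝ, 0 < σ₀ ∧ σ₀ ≤ ν * (Ta - t) ∧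
      g t x ≤ (∫ z, g Ta z * driftKernel 1 (B / ν) (ν * (Ta - t) + σ₀) (x - z)) + δ := by
    intro t ht x δ hδ
    have hdecay' : ∀ δ : ℝ, 0 < δ → ∃ ρ₀ : ℝ, ∀ s ∈ Icc t Ta, ∀ y,
        ρ₀ ≤ ‖y - (0 : EuclideanSpace ℝ (Fin 3))‖ → g s y ≤ δ := fun δ hδ => by
      obtain ⟨ρ₀, hρ₀⟩ := hdec t ht δ hδ
      exact ⟨ρ₀, fun s hs y hy => (abs_le.1 (hρ₀ s hs y hy)).2⟩
    exact prekernel_comparison hν ht.2 hB (hblock t ht) hTa0 hTac hTai hdecay' x hδ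
  have hup : ∀ t ∈ Ioo ta T, ∀ x, g t x ≤ A * Real.exp (-‖x‖ ^ 2 / a) :=
    henv Ta g F htaTa hTaT hI (fun t ht x => hFle t ht.2 x) (fun t ht x => hFnn t ht.2 x) hcomp
  -- (7) the terminal layer
  have hterm : ∀ t ∈ Ioo tₘ T, ∀ x, |g t x - F t x| ≤ B * C₁ * (T - t) := by
    intro t ht x
    rcases lt_or_ge t Ta with h | h
    · have htI : t ∈ Ioo ta Ta := ⟨htaₘ.trans ht.1, h⟩
      obtain ⟨ad, hv⟩ := hblock t htI
      have hIcc : Icc t Ta ⊆ Iio T := fun s hs => hs.2.trans_lt hTaT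
      have hpc : ∀ y : EuclideanSpace ℝ (Fin 3),
          Continuous fun s : ℝ => ((s, y) : ℝ × EuclideanSpace ℝ (Fin 3)) := fun y => by fun_prop
      have hmt : ∀ y : EuclideanSpace ℝ (Fin 3),
          MapsTo (fun s : ℝ => ((s, y) : ℝ × EuclideanSpace ℝ (Fin 3))) (Icc t Ta) (Iio T ×ˢ univ) :=
        fun y s hs => ⟨hIcc hs, mem_univ _⟩
      have key := terminal_comparison (G := g) (F := F) (L := C₁) hν h hB hv
        (fun s hs => caloric_contDiff_slice hf hfc hF s)
        (hFc.mono (prod_mono hIcc Subset.rfl))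
        (fun y s hs => caloric_hasDerivAt_time hν hf hfc hF (hIcc hs) y)
        (fun y => ((lowerOfUpper_continuousOn_fderiv_slice isOpen_Iio hF2).comp
          (hpc y).continuousOn (hmt y) :))
        (fun y => ((lowerOfUpper_continuousOn_laplacian_slice isOpen_Iio hF2).comp
          (hpc y).continuousOn (hmt y) :))
        (fun s hs y => hFD s (hIcc hs) y)
        (fun y => by rw [hgTa])
        (fun s hs y => hFnn s (hIcc hs) y)
        (fun s hs y => hnn t htI s hs y)
        (fun ε hε => by
          obtain ⟨ρ₀, hρ₀⟩ := caloric_small_far hν hF hCf0 hCf ta hε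
          exact ⟨ρ₀, fun s hs y hy => hρ₀ s ⟨htI.1.le.trans hs.1, hIcc hs⟩ y hy⟩)
        (fun ε hε => by
          obtain ⟨ρ₀, hρ₀⟩ := hdec t htI ε hε
          exact ⟨ρ₀, fun s hs y hy => (abs_le.1 (hρ₀ s hs y (by rwa [sub_zero]))).2⟩)
        t ⟨le_rfl, h.le⟩ x
      refine key.trans ?_
      exact mul_le_mul_of_nonneg_left (by linarith) (by positivity)
    · rw [hI t ⟨h, ht.2⟩, sub_self, abs_zero]
      exact mul_nonneg (by positivity) (sub_pos.2 ht.2).le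
  -- (8) the very weak identity for `g`
  have hIₘ : Ioo tₘ T ⊆ Ioo ta T := Ioo_subset_Ioo_left htaₘ.le
  have hweakg : ∀ φ : ℝ × EuclideanSpace ℝ (Fin 3) → ℝ, ContDiff ℝ ∞ φ → HasCompactSupport φ →
      tsupport φ ⊆ Ioo tₘ T ×ˢ univ →
      ∫ p : ℝ × (EuclideanSpace ℝ (Fin 3)), g p.1 p.2 * (deriv (fun s => φ (s, p.2)) p.1 +
        fderiv ℝ (fun y => φ (p.1, y)) p.2 (b p.1 p.2) -
        ν * (Δ (fun y => φ (p.1, y))) p.2) = 0 := by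
    intro φ hφ hφc hφs
    have hφs' : tsupport φ ⊆ Ioo ta T ×ˢ univ := hφs.trans (prod_mono hIₘ Subset.rfl)
    rw [← hweak φ hφ hφc hφs']
    refine integral_congr_ae ?_
    filter_upwards [hae] with p hp
    by_cases hpt : p ∈ tsupport φ
    · have hp' : F p.1 p.2 + w p = g p.1 p.2 := hp (hφs' hpt)
      rw [hp']
    · have hφ1 := weakCorrector_contDiff_one_of_infty hφ
      rw [weakCorrector_deriv_slice_eq_zero hφ1 hpt, weakCorrector_fderiv_slice_eq_zero hφ1 hpt,
        weakCorrector_laplacian_slice_eq_zero (weakCorrector_contDiff_two_of_infty hφ) hpt]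
      ring
  -- assembling on `Ioo tₘ T`
  refine ⟨g, hgs.mono hIₘ, fun t ht x => hcl t (hIₘ ht) x, hweakg, fun t ht x => hpos t (hIₘ ht) x,
    fun t ht x => hup t (hIₘ ht) x, fun t ht x => ?_⟩
  have h := hterm t ht x
  rw [hF] at h
  exact h

/-! ### Registered sub-goal -/

/-- **Registered sub-goal `stub_blockSolver_approx`** (closed form of `blockSolver_approx`,
sub-goal of STUB `stub_blockSolver`): the block solver for a cut-off drift, with constants
uniform in the cut-off. -/
theorem stub_blockSolver_approx :
    ∀ (ν B tb tₘ T : ℝ) (f : (EuclideanSpace ℝ (Fin 3)) → ℝ), 0 < ν → 0 ≤ B → tb < tₘ → tₘ < T → ContDiff ℝ 2 f → HasCompactSupport f → (∀ x, 0 ≤ f x) → ∃ A a M : ℝ, 0 < a ∧ ∀ (b : ℝ → (EuclideanSpace ℝ (Fin 3)) → (EuclideanSpace ℝ (Fin 3))), IsSmoothSpaceTimeOn (Ico tb T) b → (∀ t ∈ Ico tb T, VectorCalculus.IsDivFree (b t)) → (∀ t ∈ Ico tb T, ∀ x, ‖b t x‖ ≤ B) → (∃ T₁ ∈ Ioo tₘ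 T, ∀ t ∈ Ico T₁ T, ∀ x, b t x = 0) → ∃ W : ℝ → (EuclideanSpace ℝ (Fin 3)) → ℝ, IsSmoothSpaceTimeOn (Ioo tₘ T) W ∧ (∀ t ∈ Ioo tₘ T, ∀ x, deriv (fun s => W s x) t + fderiv ℝ (W t) x (b t x) + ν * Laplacian.laplacian (W t) x = 0) ∧ (∀ φ : ℝ × (EuclideanSpace ℝ (Fin 3)) → ℝ, ContDiff ℝ (⊤ : ℕ∞) φ → HasCompactSupport φ → tsupport φ ⊆ Ioo tₘ T ×ˢ univ → ∫ p : ℝ × (EuclideanSpace ℝ (Fin 3)), W p.1 p.2 * (deriv (fun s => φ (s, p.2)) p.1 + fderiv ℝ (fun y => φ (p.1, y)) p.2 (b p.1 p.2) - ν * Laplacian.laplacian (fun y => φ (p.1, y)) p.2) = 0) ∧ (∀ t ∈ Ioo tₘ T, ∀ x, 0 ≤ W t x) ∧ (∀ t ∈ Ioo tₘ T, ∀ x, W t x ≤ A * Real.exp (-‖x‖ ^ 2 / a)) ∧ (∀ t ∈ Ioo tₘ T, ∀ x, |W t x - Literature.Analysis.UnboundedOperators.heatExtension f (ν * (T - t))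 x| ≤ M * (T - t)) :=
  fun ν B tb tₘ T f hν hB htb htₘ hf hfc hf0 => blockSolver_approx ν B tb tₘ T f hν hB htb htₘ hf hfc hf0

end Summit.NavierStokesRegularity.NavierStokesRegularity.Theorems.AdaptedFrequencyConverges.CloudFrameEffectiveTsai

end
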